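import Summits.QuantumFields.YangMills.Theorems.BalabanUVNodesN19JointLawPriceCompositions

/-!
# YM-DAG node N19 (= NE7 proper) — MIXED ABSOLUTE MOMENTS `∏_i |x_i|^{a_i}` ARE PRICED AT THE ONE-STRING RATE `96∕(1 + log r⁻¹)`,
# UNIFORMLY IN THE EXPONENTS AND THE DIMENSION; polynomials in the absolute values by coefficient mass; powers and absolutely monotone
# links of the ℓ¹-norm `Σ_i|x_i|` at the RIDGE rate; the exponential moment of the ℓ¹-norm at `(e^{λd} − 1)·96∕(1 + log r⁻¹)`

Cell `pub-ymgap`, HUMAN RULING D-0062 (Track A) ∕ D-0149 (work-bound push), R141 (C) wider-strategy seat `pub-ymgap-dag-n19-e` (strategy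
s3 = ALTERNATIVE CURRENCY), generation g29, module 1 (lineage module 115).  Route `Summits/QuantumFields/YangMills/Theses/BalabanUVNodes.lean`,
cluster item K3⁸ «SpineGivenEndpointR13SepCoPHV» (stmt-QuantumFields-27366); filed `--supports` that item `--as helper` (it proves no registered
stub).  COUNT-NEUTRAL: [folklore] bookkeeping over Mathlib and the lineage BY NAME — module 63 `…N19UniformMomentPriceTwoSided`
(`law_price_le_of_uniformMoments`, the one-dimensional closed form `48(K+G)∕(1 + log r⁻¹)`), p568465 `…N19JointLawBernstein`
(`integrable_of_continuous_of_cube`), module 108 `…N19JointLawPriceRidge` (`prod_apply_eq_prod_pow_card`, `sum_prod_abs_eq_pow`), module 67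
`…N19JointLawClosedFormAtScheme` (`jointLaw_pushforward`, §6 only); NOT a discharge claim.

CONTEXT (CURRENCY-MAP v7, open item (v′)).  Under uniform mixed-moment closeness `r` (`L = log r⁻¹`) of two laws `P, Q` on `[−1,1]^ι`
(`d = |ι|`) the joint-law price is `Θ(d²∕(d + L))` for general ℓ¹-Lipschitz functionals (module 107), `Θ(A∕L)` for RIDGE functionals (module 108),
linear in `d` for Lipschitz links of additive POLYNOMIAL statistics (module 110) and `≲ d∕√L` for Lipschitz links of sums of Lipschitz
one-string observables such as `h(Σ_i|x_i|)` (module 111, nesting; conjectured `Θ(d∕L)`, numerically ridge-like — CURRENCY-MAP v7).  A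
TENSOR scheme prices a product of `k` kinked one-string factors at `≍ k²∕L` (per-factor Jackson errors add up to `kπ∕m`, the joint
coefficient mass `(m9^m)^k` forces `m ≍ L∕(k log 9)`; module 65's accounting).
THE DEVICE OF THIS MODULE.  `∏_i |x_i|^{a_i} = |∏_i x_i^{a_i}|` is a LIPSCHITZ PROFILE OF ONE MONOMIAL, and the push-forward laws of `P, Q`
under a monomial `x ↦ x^a` have `r`-close moments (`∫(x^a)^n = ∫x^{na}`); so module 63 prices it at the ONE-string rate — no `d`, no `a`.
§1 MONOMIAL PROFILES: `abs_monomial_le_one` · `monomial_mem_Icc` · `continuous_monomial` · `map_monomial_Icc_compl` · `integral_map_monomial` ·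
   `abs_integral_monomial_pow_sub_le` · ★ `law_price_monomialProfile_le` (`g(∏_i x_i^{a_i})`, `g` `K`-Lipschitz `G`-bounded on `[−1,1]`:
   `48(K + G)∕(1 + L)`).
§2 ★★ `abs_integral_prodAbsPow_sub_le`: `|∫∏_i|x_i|^{a_i} dP − ∫∏_i|x_i|^{a_i} dQ| ≤ 96∕(1 + L)` for EVERY exponent vector `a` — DIMENSION-FREE
   (the tensor bound for a product of `k = #{i : a_i odd}` kinked factors is `≍ k²∕L`).
§3 ★ `law_price_absPolynomial_le`: a polynomial `G` in the absolute values, `|∫G(|x|) dP − ∫G(|x|) dQ| ≤ Λ(G)·96∕(1 + L)`, `Λ(G) = Σ_d|[r^d]G|`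
   (`MvPolynomial.eval`; the dimension enters only through the coefficient mass).
§4 LINKS OF THE ℓ¹-NORM `S = Σ_i|x_i|`: `l1NormPow_eq_sum` · ★ `abs_integral_l1NormPow_sub_le` (`S^n`: `d^n·96∕(1+L)`) ·
   `abs_integral_l1NormPow_div_sub_le` (`(S∕d)^n`: `96∕(1+L)` — no `d`, no `n`) · `abs_integral_l1NormSeries_sub_le` (`Σ_{p≤D} c_p S^p`:
   `(Σ_{1≤p≤D}|c_p|d^p)·96∕(1+L)`, the constant term free) · ★★ `law_price_l1NormLink_le` (a polynomial link `f(S)`, `deg f ≤ D`: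
   `(Σ_{1≤p≤D}|[s^p]f|·d^p)·96∕(1+L)` — for an ABSOLUTELY MONOTONE link (`[s^p]f ≥ 0`) this is `(f(d) − f(0))·96∕(1+L) ≤ d·Lip(f)·96∕(1+L)`:
   the RIDGE rate conjectured in (v′), proved for this sub-class).
§5 ★★ `abs_integral_exp_l1Norm_sub_le`: `|∫e^{tS} dP − ∫e^{tS} dQ| ≤ (e^{td} − 1)·96∕(1 + L)` (`t ≥ 0`; §4 on the Taylor polynomials, dominated
   convergence) — against the tensor bound `≍ d²·t·e^{td}∕L` and module 111's `≍ d·t·e^{td}∕√L`.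
§6 AT THE SCHEME (module 67's `jointLaw_pushforward` BY NAME, CONDITIONAL on the uniform `Target`): `abs_integral_prodAbsPow_sub_jointLaw_le_of_uniformTarget`
   (mixed absolute moments of `d` strings converge at the one-string rate `96∕(1 + log R_K⁻¹)`) · `abs_integral_exp_l1Norm_sub_jointLaw_le_of_uniformTarget`.
READING for N19 (honest): under the UNIFORM target, every mixed ABSOLUTE moment `E∏_i|∏os_i|^{a_i}` of a finite family of strings, every power of
`Σ_i|∏os_i|` normalised by `d^p`, and the exponential moment of `Σ_i|∏os_i|` normalised by `e^{td} − 1` converge at the ONE-string rate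
`≍ 1∕log R_K⁻¹`, whatever `d` and the exponents; the composition question (v′) is thereby settled at the ridge rate for absolutely monotone links.
What stays OPEN is the OSCILLATING link (`cos(ωS)`, zigzags), whose absolute coefficient mass `Σ_p|[s^p]f|d^p` is exponential in its degree.

HONEST FRAMING (binding).  Elementary and [folklore]; ONE-SIDED (upper bounds; the class is two-sided only through module 66's additive witness
`Σ_i|x_i|`, mass `d`); TOY laws; NO consumer in the DAG today (an optimality map of the seat's own currency); nothing of Bałaban's instantiated;
NE7 NOT PRINTED, NOT proved; N19 NOT discharged; count-neutral.  One finite `T⁴` programme at fixed `ε`; nothing continuum ∕ `ℝ⁴` ∕ OS ∕ mass-gap ∕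
Clay.  0 `def` ∕ 0 `sorry`.
-/

noncomputable section

open Real Finset MeasureTheory Filter Topology

namespace Summit.QuantumFields.YangMills.Theorems.BalabanUVNodesN19JointLawPriceAbsolutePolynomials

open Summit.QuantumFields.YangMills.Theorems.BalabanUVNodesN19UniformMomentPriceTwoSided (law_price_le_of_uniformMoments)
open Summit.QuantumFields.YangMills.Theorems.BalabanUVNodesN19JointLawBernstein (integrable_of_continuous_of_cube)
open Summit.QuantumFields.YangMills.Theorems.BalabanUVNodesN19JointLawPriceRidge (prod_apply_eq_prod_pow_card sum_prod_abs_eq_pow)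

variable {ι : Type*} [Fintype ι]

/-! ## §1 Lipschitz profiles of ONE monomial are one-string-rate objects [folklore] -/

/-- On the cube a monomial is bounded by one: `|∏_i x_i^{a_i}| ≤ 1`. [bookkeeping] -/
theorem abs_monomial_le_one {x : ι → ℝ} (hx : ∀ i, x i ∈ Set.Icc (-1 : ℝ) 1) (a : ι → ℕ) : |∏ i, x i ^ a i| ≤ 1 := by
  rw [Finset.abs_prod]
  refine Finset.prod_le_one (fun i _ => abs_nonneg _) fun i _ => ?_
  rw [abs_pow]
  exact pow_le_one₀ (abs_nonneg _) (abs_le.2 ⟨(hx i).1, (hx i).2⟩)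

/-- On the cube a monomial takes values in `[−1,1]`. [bookkeeping] -/
theorem monomial_mem_Icc {x : ι → ℝ} (hx : ∀ i, x i ∈ Set.Icc (-1 : ℝ) 1) (a : ι → ℕ) :
    ∏ i, x i ^ a i ∈ Set.Icc (-1 : ℝ) 1 :=
  Set.mem_Icc.2 (abs_le.1 (abs_monomial_le_one hx a))

/-- A monomial is continuous. [bookkeeping] -/
theorem continuous_monomial (a : ι → ℕ) : Continuous fun x : ι → ℝ => ∏ i, x i ^ a i :=
  continuous_finsetProd _ fun i _ => (continuous_apply i).pow _

/-- The push-forward of a law on the cube under a monomial is carried by `[−1,1]`. [bookkeeping] -/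
theorem map_monomial_Icc_compl {P : Measure (ι → ℝ)} (hP : P (Set.pi Set.univ (fun _ : ι => Set.Icc (-1 : ℝ) 1))ᶜ = 0)
    (a : ι → ℕ) : (P.map fun x : ι → ℝ => ∏ i, x i ^ a i) (Set.Icc (-1 : ℝ) 1)ᶜ = 0 := by
  rw [Measure.map_apply (continuous_monomial a).measurable measurableSet_Icc.compl]
  refine measure_mono_null (fun x hx => ?_) hP
  intro hxc
  exact hx (monomial_mem_Icc (fun i => Set.mem_univ_pi.1 hxc i) a)

/-- Integration against the push-forward under a monomial. [bookkeeping] -/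
theorem integral_map_monomial (P : Measure (ι → ℝ)) (a : ι → ℕ) {g : ℝ → ℝ} (hg : Continuous g) :
    ∫ s, g s ∂(P.map fun x : ι → ℝ => ∏ i, x i ^ a i) = ∫ x, g (∏ i, x i ^ a i) ∂P :=
  integral_map (continuous_monomial a).measurable.aemeasurable hg.aestronglyMeasurable

/-- The moments of a monomial ARE mixed moments: under `r`-closeness of all mixed moments, `|∫(x^a)^n dP − ∫(x^a)^n dQ| ≤ r`. [bookkeeping] -/
theorem abs_integral_monomial_pow_sub_le {P Q : Measure (ι → ℝ)} {r : ℝ}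
    (hmom : ∀ j : ι → ℕ, |∫ x, ∏ i, x i ^ j i ∂P - ∫ x, ∏ i, x i ^ j i ∂Q| ≤ r) (a : ι → ℕ) (n : ℕ) :
    |∫ x, (∏ i, x i ^ a i) ^ n ∂P - ∫ x, (∏ i, x i ^ a i) ^ n ∂Q| ≤ r := by
  have h : (fun x : ι → ℝ => (∏ i, x i ^ a i) ^ n) = fun x => ∏ i, x i ^ (a i * n) := by
    funext x
    rw [← Finset.prod_pow]
    exact Finset.prod_congr rfl fun i _ => (pow_mul (x i) (a i) n).symm
  rw [h]
  exact hmom fun i => a i * n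

/-- ★ **LIPSCHITZ PROFILES OF ONE MONOMIAL: `48(K + G)∕(1 + log r⁻¹)`.**  `P, Q` on `[−1,1]^ι` with all mixed moments `r`-close (`0 < r ≤ 1`);
`a : ι → ℕ`; `g` continuous, `K`-Lipschitz and `G`-bounded on `[−1,1]`.  Then `|∫g(∏_i x_i^{a_i}) dP − ∫g(∏_i x_i^{a_i}) dQ| ≤ 48(K + G)∕(1 + log r⁻¹)`
— the push-forwards under the monomial are laws on `[−1,1]` with `r`-close moments, priced by module 63.  No dependence on `a` or `|ι|`. [folklore] -/
theorem law_price_monomialProfile_le {P Q : Measure (ι → ℝ)} [IsProbabilityMeasure P] [IsProbabilityMeasure Q]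
    (hP : P (Set.pi Set.univ (fun _ : ι => Set.Icc (-1 : ℝ) 1))ᶜ = 0) (hQ : Q (Set.pi Set.univ (fun _ : ι => Set.Icc (-1 : ℝ) 1))ᶜ = 0)
    {r : ℝ} (hr0 : 0 < r) (hr1 : r ≤ 1)
    (hmom : ∀ j : ι → ℕ, |∫ x, ∏ i, x i ^ j i ∂P - ∫ x, ∏ i, x i ^ j i ∂Q| ≤ r)
    (a : ι → ℕ) {g : ℝ → ℝ} (hg : Continuous g) {K G : ℝ} (hK0 : 0 ≤ K)
    (hK : ∀ s s' : ℝ, s ∈ Set.Icc (-1 : ℝ) 1 → s' ∈ Set.Icc (-1 : ℝ) 1 → |g s - g s'| ≤ K * |s - s'|)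
    (hG : ∀ s : ℝ, s ∈ Set.Icc (-1 : ℝ) 1 → |g s| ≤ G) :
    |∫ x, g (∏ i, x i ^ a i) ∂P - ∫ x, g (∏ i, x i ^ a i) ∂Q| ≤ 48 * (K + G) / (1 + Real.log r⁻¹) := by
  haveI : IsProbabilityMeasure (P.map fun x : ι → ℝ => ∏ i, x i ^ a i) :=
    Measure.isProbabilityMeasure_map (continuous_monomial a).measurable.aemeasurable
  haveI : IsProbabilityMeasure (Q.map fun x : ι → ℝ => ∏ i, x i ^ a i) :=
    Measure.isProbabilityMeasure_map (continuous_monomial a).measurable.aemeasurable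
  have hmomu : ∀ n : ℕ, |∫ s, s ^ n ∂(P.map fun x : ι → ℝ => ∏ i, x i ^ a i) -
      ∫ s, s ^ n ∂(Q.map fun x : ι → ℝ => ∏ i, x i ^ a i)| ≤ r := fun n => by
    rw [integral_map_monomial P a (continuous_pow n), integral_map_monomial Q a (continuous_pow n)]
    exact abs_integral_monomial_pow_sub_le hmom a n
  have hprice := law_price_le_of_uniformMoments (μ := Q.map fun x : ι → ℝ => ∏ i, x i ^ a i)
    (ν := P.map fun x : ι → ℝ => ∏ i, x i ^ a i) (map_monomial_Icc_compl hQ a) (map_monomial_Icc_compl hP a) hr0 hr1 hmomu hg hK0 hK hG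
  rwa [integral_map_monomial P a hg, integral_map_monomial Q a hg] at hprice

/-! ## §2 ★★ Mixed absolute moments are priced at the one-string rate, uniformly in the exponents and the dimension [folklore] -/

/-- ★★ **MIXED ABSOLUTE MOMENTS: `96∕(1 + log r⁻¹)`, NO `a`, NO `|ι|`.**  `P, Q` on `[−1,1]^ι` with all mixed moments `r`-close (`0 < r ≤ 1`).
For EVERY exponent vector `a : ι → ℕ`: `|∫∏_i|x_i|^{a_i} dP − ∫∏_i|x_i|^{a_i} dQ| ≤ 96∕(1 + log r⁻¹)` — `∏_i|x_i|^{a_i} = |∏_i x_i^{a_i}|` is the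
`1`-Lipschitz `1`-bounded profile `|·|` of ONE monomial (§1).  Priced as a tensor product of its `k = #{i : a_i odd}` kinked one-string factors
(module 65's scheme) it would cost `≍ k²∕(1 + log r⁻¹)`. [folklore] -/
theorem abs_integral_prodAbsPow_sub_le {P Q : Measure (ι → ℝ)} [IsProbabilityMeasure P] [IsProbabilityMeasure Q]
    (hP : P (Set.pi Set.univ (fun _ : ι => Set.Icc (-1 : ℝ) 1))ᶜ = 0) (hQ : Q (Set.pi Set.univ (fun _ : ι => Set.Icc (-1 : ℝ) 1))ᶜ = 0)
    {r : ℝ} (hr0 : 0 < r) (hr1 : r ≤ 1)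
    (hmom : ∀ j : ι → ℕ, |∫ x, ∏ i, x i ^ j i ∂P - ∫ x, ∏ i, x i ^ j i ∂Q| ≤ r) (a : ι → ℕ) :
    |∫ x, ∏ i, |x i| ^ a i ∂P - ∫ x, ∏ i, |x i| ^ a i ∂Q| ≤ 96 / (1 + Real.log r⁻¹) := by
  have hfun : (fun x : ι → ℝ => ∏ i, |x i| ^ a i) = fun x => |∏ i, x i ^ a i| := by
    funext x
    rw [Finset.abs_prod]
    exact Finset.prod_congr rfl fun i _ => (abs_pow (x i) (a i)).symm
  have hK : ∀ s s' : ℝ, s ∈ Set.Icc (-1 : ℝ) 1 → s' ∈ Set.Icc (-1 : ℝ) 1 → |abs s - abs s'| ≤ 1 * |s - s'| :=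
    fun s s' _ _ => by rw [one_mul]; exact abs_abs_sub_abs_le_abs_sub s s'
  have hG : ∀ s : ℝ, s ∈ Set.Icc (-1 : ℝ) 1 → |abs s| ≤ 1 := fun s hs => by
    rw [abs_abs]; exact abs_le.2 ⟨hs.1, hs.2⟩
  have h := law_price_monomialProfile_le hP hQ hr0 hr1 hmom a continuous_abs zero_le_one hK hG
  rw [hfun]
  calc |∫ x, |∏ i, x i ^ a i| ∂P - ∫ x, |∏ i, x i ^ a i| ∂Q| ≤ 48 * (1 + 1) / (1 + Real.log r⁻¹) := h
    _ = 96 / (1 + Real.log r⁻¹) := by norm_num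

/-! ## §3 ★ Polynomials in the absolute values, priced by coefficient mass [folklore] -/

/-- ★ **POLYNOMIALS IN THE ABSOLUTE VALUES: `Λ(G)·96∕(1 + log r⁻¹)`.**  `P, Q` on `[−1,1]^ι` with all mixed moments `r`-close (`0 < r ≤ 1`); `G` a
real polynomial in `|ι|` variables with coefficient mass `Λ(G) = Σ_d|[r^d]G|` (constant term included; apply to `G − G(0)` to drop it).  Then
`|∫G(|x_1|,…,|x_d|) dP − ∫G(|x_1|,…,|x_d|) dQ| ≤ Λ(G)·96∕(1 + log r⁻¹)` — the dimension enters ONLY through `Λ(G)`. [folklore] -/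
theorem law_price_absPolynomial_le {P Q : Measure (ι → ℝ)} [IsProbabilityMeasure P] [IsProbabilityMeasure Q]
    (hP : P (Set.pi Set.univ (fun _ : ι => Set.Icc (-1 : ℝ) 1))ᶜ = 0) (hQ : Q (Set.pi Set.univ (fun _ : ι => Set.Icc (-1 : ℝ) 1))ᶜ = 0)
    {r : ℝ} (hr0 : 0 < r) (hr1 : r ≤ 1)
    (hmom : ∀ j : ι → ℕ, |∫ x, ∏ i, x i ^ j i ∂P - ∫ x, ∏ i, x i ^ j i ∂Q| ≤ r) (G : MvPolynomial ι ℝ) :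
    |∫ x, MvPolynomial.eval (fun i => |x i|) G ∂P - ∫ x, MvPolynomial.eval (fun i => |x i|) G ∂Q| ≤
      (∑ d ∈ G.support, |G.coeff d|) * (96 / (1 + Real.log r⁻¹)) := by
  classical
  have hfun : (fun x : ι → ℝ => MvPolynomial.eval (fun i => |x i|) G) =
      fun x => ∑ d ∈ G.support, G.coeff d * ∏ i, |x i| ^ d i := by
    funext x; exact MvPolynomial.eval_eq' _ _
  have hcont : ∀ d : ι →₀ ℕ, Continuous fun x : ι → ℝ => G.coeff d * ∏ i, |x i| ^ d i := fun d =>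
    continuous_const.mul (continuous_finsetProd _ fun i _ => (continuous_apply i).abs.pow _)
  have hexp : ∀ (μ : Measure (ι → ℝ)) [IsProbabilityMeasure μ], μ (Set.pi Set.univ (fun _ : ι => Set.Icc (-1 : ℝ) 1))ᶜ = 0 →
      ∫ x, MvPolynomial.eval (fun i => |x i|) G ∂μ = ∑ d ∈ G.support, G.coeff d * ∫ x, ∏ i, |x i| ^ d i ∂μ := by
    intro μ _ hμ
    rw [hfun, integral_finsetSum _ (fun d _ => integrable_of_continuous_of_cube hμ (hcont d))]
    exact Finset.sum_congr rfl fun d _ => integral_const_mul _ _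
  rw [hexp P hP, hexp Q hQ, ← Finset.sum_sub_distrib, Finset.sum_mul]
  refine (abs_sum_le_sum_abs _ _).trans (Finset.sum_le_sum fun d _ => ?_)
  rw [← mul_sub, abs_mul]
  exact mul_le_mul_of_nonneg_left (abs_integral_prodAbsPow_sub_le hP hQ hr0 hr1 hmom fun i => d i) (abs_nonneg _)

/-! ## §4 Links of the ℓ¹-norm `S = Σ_i|x_i|`: powers, power series, polynomial links [folklore] -/

/-- `(Σ_i|x_i|)^n = Σ_{f : Fin n → ι} ∏_i |x_i|^{#f⁻¹(i)}` — each term a mixed absolute moment (module 108's fibre bookkeeping). [bookkeeping] -/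
theorem l1NormPow_eq_sum [DecidableEq ι] (x : ι → ℝ) (n : ℕ) :
    (∑ i, |x i|) ^ n = ∑ f : Fin n → ι, ∏ i, |x i| ^ (Finset.univ.filter fun k => f k = i).card := by
  rw [← sum_prod_abs_eq_pow x n]
  exact Finset.sum_congr rfl fun f _ => prod_apply_eq_prod_pow_card f fun i => |x i|

/-- On the cube `Σ_i|x_i| ≤ |ι|`. [bookkeeping] -/
theorem l1Norm_le_card {x : ι → ℝ} (hx : ∀ i, x i ∈ Set.Icc (-1 : ℝ) 1) : ∑ i, |x i| ≤ Fintype.card ι := by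
  calc ∑ i, |x i| ≤ ∑ _i : ι, (1 : ℝ) := Finset.sum_le_sum fun i _ => abs_le.2 ⟨(hx i).1, (hx i).2⟩
    _ = Fintype.card ι := by rw [Finset.sum_const, Finset.card_univ, nsmul_eq_mul, mul_one]

/-- ★ **POWERS OF THE ℓ¹-NORM: `d^n·96∕(1 + log r⁻¹)`.**  `P, Q` on `[−1,1]^ι` with all mixed moments `r`-close (`0 < r ≤ 1`), `d = |ι|`.
Then `|∫(Σ_i|x_i|)^n dP − ∫(Σ_i|x_i|)^n dQ| ≤ d^n·96∕(1 + log r⁻¹)` for every `n` — `d^n` mixed absolute moments (§2) of weight one each. [folklore] -/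
theorem abs_integral_l1NormPow_sub_le {P Q : Measure (ι → ℝ)} [IsProbabilityMeasure P] [IsProbabilityMeasure Q]
    (hP : P (Set.pi Set.univ (fun _ : ι => Set.Icc (-1 : ℝ) 1))ᶜ = 0) (hQ : Q (Set.pi Set.univ (fun _ : ι => Set.Icc (-1 : ℝ) 1))ᶜ = 0)
    {r : ℝ} (hr0 : 0 < r) (hr1 : r ≤ 1)
    (hmom : ∀ j : ι → ℕ, |∫ x, ∏ i, x i ^ j i ∂P - ∫ x, ∏ i, x i ^ j i ∂Q| ≤ r) (n : ℕ) :
    |∫ x, (∑ i, |x i|) ^ n ∂P - ∫ x, (∑ i, |x i|) ^ n ∂Q| ≤ (Fintype.card ι : ℝ) ^ n * (96 / (1 + Real.log r⁻¹)) := by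
  classical
  have hcont : ∀ f : Fin n → ι,
      Continuous fun x : ι → ℝ => ∏ i, |x i| ^ (Finset.univ.filter fun k => f k = i).card := fun f =>
    continuous_finsetProd _ fun i _ => (continuous_apply i).abs.pow _
  have hexp : ∀ (μ : Measure (ι → ℝ)) [IsProbabilityMeasure μ], μ (Set.pi Set.univ (fun _ : ι => Set.Icc (-1 : ℝ) 1))ᶜ = 0 →
      ∫ x, (∑ i, |x i|) ^ n ∂μ = ∑ f : Fin n → ι, ∫ x, ∏ i, |x i| ^ (Finset.univ.filter fun k => f k = i).card ∂μ := by
    intro μ _ hμ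
    have hfun : (fun x : ι → ℝ => (∑ i, |x i|) ^ n) =
        fun x => ∑ f : Fin n → ι, ∏ i, |x i| ^ (Finset.univ.filter fun k => f k = i).card := by
      funext x; exact l1NormPow_eq_sum x n
    rw [hfun, integral_finsetSum _ (fun f _ => integrable_of_continuous_of_cube hμ (hcont f))]
  rw [hexp P hP, hexp Q hQ, ← Finset.sum_sub_distrib]
  calc |∑ f : Fin n → ι, (∫ x, ∏ i, |x i| ^ (Finset.univ.filter fun k => f k = i).card ∂P -
          ∫ x, ∏ i, |x i| ^ (Finset.univ.filter fun k => f k = i).card ∂Q)|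
      ≤ ∑ f : Fin n → ι, |∫ x, ∏ i, |x i| ^ (Finset.univ.filter fun k => f k = i).card ∂P -
          ∫ x, ∏ i, |x i| ^ (Finset.univ.filter fun k => f k = i).card ∂Q| := abs_sum_le_sum_abs _ _
    _ ≤ ∑ _f : Fin n → ι, 96 / (1 + Real.log r⁻¹) := Finset.sum_le_sum fun f _ =>
        abs_integral_prodAbsPow_sub_le hP hQ hr0 hr1 hmom fun i => (Finset.univ.filter fun k => f k = i).card
    _ = (Fintype.card ι : ℝ) ^ n * (96 / (1 + Real.log r⁻¹)) := by
        rw [Finset.sum_const, Finset.card_univ, Fintype.card_fun, Fintype.card_fin, nsmul_eq_mul, Nat.cast_pow]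

/-- **NORMALISED POWERS `(S∕d)^n`: `96∕(1 + log r⁻¹)` — no `d`, no `n`.**  In the setting of `abs_integral_l1NormPow_sub_le` (`ι` nonempty):
`|∫(Σ_i|x_i|∕d)^n dP − ∫(Σ_i|x_i|∕d)^n dQ| ≤ 96∕(1 + log r⁻¹)`. [folklore] -/
theorem abs_integral_l1NormPow_div_sub_le [Nonempty ι] {P Q : Measure (ι → ℝ)} [IsProbabilityMeasure P] [IsProbabilityMeasure Q]
    (hP : P (Set.pi Set.univ (fun _ : ι => Set.Icc (-1 : ℝ) 1))ᶜ = 0) (hQ : Q (Set.pi Set.univ (fun _ : ι => Set.Icc (-1 : ℝ) 1))ᶜ = 0)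
    {r : ℝ} (hr0 : 0 < r) (hr1 : r ≤ 1)
    (hmom : ∀ j : ι → ℕ, |∫ x, ∏ i, x i ^ j i ∂P - ∫ x, ∏ i, x i ^ j i ∂Q| ≤ r) (n : ℕ) :
    |∫ x, ((∑ i, |x i|) / Fintype.card ι) ^ n ∂P - ∫ x, ((∑ i, |x i|) / Fintype.card ι) ^ n ∂Q| ≤ 96 / (1 + Real.log r⁻¹) := by
  have hd : (0 : ℝ) < Fintype.card ι := Nat.cast_pos.2 Fintype.card_pos
  have hdiv : ∀ μ : Measure (ι → ℝ),
      ∫ x, ((∑ i, |x i|) / Fintype.card ι) ^ n ∂μ = (∫ x, (∑ i, |x i|) ^ n ∂μ) / (Fintype.card ι : ℝ) ^ n := by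
    intro μ; simp_rw [div_pow]; rw [integral_div]
  rw [hdiv P, hdiv Q, ← sub_div, abs_div, abs_of_pos (pow_pos hd n), div_le_iff₀ (pow_pos hd n)]
  calc |∫ x, (∑ i, |x i|) ^ n ∂P - ∫ x, (∑ i, |x i|) ^ n ∂Q| ≤ (Fintype.card ι : ℝ) ^ n * (96 / (1 + Real.log r⁻¹)) :=
        abs_integral_l1NormPow_sub_le hP hQ hr0 hr1 hmom n
    _ = 96 / (1 + Real.log r⁻¹) * (Fintype.card ι : ℝ) ^ n := mul_comm _ _

/-- **POWER SERIES IN THE ℓ¹-NORM, THE CONSTANT TERM FREE.**  `P, Q` on `[−1,1]^ι` with all mixed moments `r`-close (`0 < r ≤ 1`), `d = |ι|`,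
coefficients `c : ℕ → ℝ`, `D : ℕ`.  Then `|∫Σ_{p≤D} c_p(Σ_i|x_i|)^p dP − ∫Σ_{p≤D} c_p(Σ_i|x_i|)^p dQ| ≤ (Σ_{p<D}|c_{p+1}|·d^{p+1})·96∕(1 + log r⁻¹)`
(§4's powers summed; the constant term is paid nothing). [folklore] -/
theorem abs_integral_l1NormSeries_sub_le {P Q : Measure (ι → ℝ)} [IsProbabilityMeasure P] [IsProbabilityMeasure Q]
    (hP : P (Set.pi Set.univ (fun _ : ι => Set.Icc (-1 : ℝ) 1))ᶜ = 0) (hQ : Q (Set.pi Set.univ (fun _ : ι => Set.Icc (-1 : ℝ) 1))ᶜ = 0)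
    {r : ℝ} (hr0 : 0 < r) (hr1 : r ≤ 1)
    (hmom : ∀ j : ι → ℕ, |∫ x, ∏ i, x i ^ j i ∂P - ∫ x, ∏ i, x i ^ j i ∂Q| ≤ r) (c : ℕ → ℝ) (D : ℕ) :
    |∫ x, ∑ p ∈ range (D + 1), c p * (∑ i, |x i|) ^ p ∂P - ∫ x, ∑ p ∈ range (D + 1), c p * (∑ i, |x i|) ^ p ∂Q| ≤
      (∑ p ∈ range D, |c (p + 1)| * (Fintype.card ι : ℝ) ^ (p + 1)) * (96 / (1 + Real.log r⁻¹)) := by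
  have hcont : ∀ p : ℕ, Continuous fun x : ι → ℝ => c p * (∑ i, |x i|) ^ p := fun p =>
    continuous_const.mul ((continuous_finsetSum _ fun i _ => (continuous_apply i).abs).pow _)
  have hexp : ∀ (μ : Measure (ι → ℝ)) [IsProbabilityMeasure μ], μ (Set.pi Set.univ (fun _ : ι => Set.Icc (-1 : ℝ) 1))ᶜ = 0 →
      ∫ x, ∑ p ∈ range (D + 1), c p * (∑ i, |x i|) ^ p ∂μ = ∑ p ∈ range (D + 1), c p * ∫ x, (∑ i, |x i|) ^ p ∂μ := by
    intro μ _ hμ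
    rw [integral_finsetSum _ (fun p _ => integrable_of_continuous_of_cube hμ (hcont p))]
    exact Finset.sum_congr rfl fun p _ => integral_const_mul _ _
  have h0 : (∫ x, (∑ i, |x i|) ^ 0 ∂P) - ∫ x, (∑ i, |x i|) ^ 0 ∂Q = 0 := by
    simp only [pow_zero, integral_const, probReal_univ, one_smul, sub_self]
  have hsplit : ∑ p ∈ range (D + 1), (c p * ∫ x, (∑ i, |x i|) ^ p ∂P - c p * ∫ x, (∑ i, |x i|) ^ p ∂Q) =
      ∑ p ∈ range D, c (p + 1) * ((∫ x, (∑ i, |x i|) ^ (p + 1) ∂P) - ∫ x, (∑ i, |x i|) ^ (p + 1) ∂Q) := by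
    rw [Finset.sum_range_succ', ← mul_sub, h0, mul_zero, add_zero]
    exact Finset.sum_congr rfl fun p _ => (mul_sub _ _ _).symm
  rw [hexp P hP, hexp Q hQ, ← Finset.sum_sub_distrib, hsplit, Finset.sum_mul]
  refine (abs_sum_le_sum_abs _ _).trans (Finset.sum_le_sum fun p _ => ?_)
  rw [abs_mul, mul_assoc]
  exact mul_le_mul_of_nonneg_left (abs_integral_l1NormPow_sub_le hP hQ hr0 hr1 hmom (p + 1)) (abs_nonneg _)

/-- ★★ **POLYNOMIAL LINKS OF THE ℓ¹-NORM BY ABSOLUTE COEFFICIENT MASS.**  `P, Q` on `[−1,1]^ι` with all mixed moments `r`-close (`0 < r ≤ 1`),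
`d = |ι|`, `f` a real polynomial of degree `≤ D`.  Then
`|∫f(Σ_i|x_i|) dP − ∫f(Σ_i|x_i|) dQ| ≤ (Σ_{p<D}|[s^{p+1}]f|·d^{p+1})·96∕(1 + log r⁻¹)`.
For an ABSOLUTELY MONOTONE link (`[s^p]f ≥ 0` for `p ≥ 1`) the mass is `f(d) − f(0) ≤ d·sup_{[0,d]}f′`: such links of the ℓ¹-norm of `d` strings
are priced at the RIDGE rate `d·Lip∕L` (CURRENCY-MAP v7's conjecture (v′), this sub-class), against module 111's `d∕√L`. [folklore] -/
theorem law_price_l1NormLink_le {P Q : Measure (ι → ℝ)} [IsProbabilityMeasure P] [IsProbabilityMeasure Q]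
    (hP : P (Set.pi Set.univ (fun _ : ι => Set.Icc (-1 : ℝ) 1))ᶜ = 0) (hQ : Q (Set.pi Set.univ (fun _ : ι => Set.Icc (-1 : ℝ) 1))ᶜ = 0)
    {r : ℝ} (hr0 : 0 < r) (hr1 : r ≤ 1)
    (hmom : ∀ j : ι → ℕ, |∫ x, ∏ i, x i ^ j i ∂P - ∫ x, ∏ i, x i ^ j i ∂Q| ≤ r) (f : Polynomial ℝ) {D : ℕ}
    (hf : f.natDegree ≤ D) :
    |∫ x, f.eval (∑ i, |x i|) ∂P - ∫ x, f.eval (∑ i, |x i|) ∂Q| ≤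
      (∑ p ∈ range D, |f.coeff (p + 1)| * (Fintype.card ι : ℝ) ^ (p + 1)) * (96 / (1 + Real.log r⁻¹)) := by
  have hfun : (fun x : ι → ℝ => f.eval (∑ i, |x i|)) = fun x => ∑ p ∈ range (D + 1), f.coeff p * (∑ i, |x i|) ^ p := by
    funext x; exact Polynomial.eval_eq_sum_range' (Nat.lt_succ_of_le hf) _
  rw [hfun]
  exact abs_integral_l1NormSeries_sub_le hP hQ hr0 hr1 hmom (fun p => f.coeff p) D

/-! ## §5 ★★ The exponential moment of the ℓ¹-norm [folklore] -/

/-- ★★ **THE EXPONENTIAL MOMENT OF THE ℓ¹-NORM: `(e^{td} − 1)·96∕(1 + log r⁻¹)`.**  `P, Q` on `[−1,1]^ι` with all mixed moments `r`-close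
(`0 < r ≤ 1`), `d = |ι|`, `t ≥ 0`.  Then `|∫exp(t·Σ_i|x_i|) dP − ∫exp(t·Σ_i|x_i|) dQ| ≤ (e^{td} − 1)·96∕(1 + log r⁻¹)` — §4 on the Taylor
polynomials `Σ_{p≤D}t^p S^p∕p!` (absolute coefficient mass `Σ_{1≤p≤D}(td)^p∕p! ≤ e^{td} − 1`), which converge to `e^{tS}` dominatedly by `e^{td}` on
the cube.  For comparison: the tensor bound for `e^{tS} = ∏_i e^{t|x_i|}` (module 65's scheme) is `≍ d²·t·e^{td}∕log r⁻¹`, module 111's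
nesting bound `≍ d·t·e^{td}∕√(log r⁻¹)`. [folklore] -/
theorem abs_integral_exp_l1Norm_sub_le {P Q : Measure (ι → ℝ)} [IsProbabilityMeasure P] [IsProbabilityMeasure Q]
    (hP : P (Set.pi Set.univ (fun _ : ι => Set.Icc (-1 : ℝ) 1))ᶜ = 0) (hQ : Q (Set.pi Set.univ (fun _ : ι => Set.Icc (-1 : ℝ) 1))ᶜ = 0)
    {r : ℝ} (hr0 : 0 < r) (hr1 : r ≤ 1)
    (hmom : ∀ j : ι → ℕ, |∫ x, ∏ i, x i ^ j i ∂P - ∫ x, ∏ i, x i ^ j i ∂Q| ≤ r) {t : ℝ} (ht : 0 ≤ t) :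
    |∫ x, Real.exp (t * ∑ i, |x i|) ∂P - ∫ x, Real.exp (t * ∑ i, |x i|) ∂Q| ≤
      (Real.exp (t * Fintype.card ι) - 1) * (96 / (1 + Real.log r⁻¹)) := by
  set S : (ι → ℝ) → ℝ := fun x => ∑ i, |x i| with hS
  -- the Taylor polynomials of the exponential link
  set F : ℕ → (ι → ℝ) → ℝ := fun D x => ∑ p ∈ range (D + 1), t ^ p / (p.factorial : ℝ) * S x ^ p with hF
  have hScont : Continuous S := continuous_finsetSum _ fun i _ => (continuous_apply i).abs
  have hFcont : ∀ D, Continuous (F D) := fun D => continuous_finsetSum _ fun p _ => continuous_const.mul (hScont.pow _)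
  have hS0 : ∀ x, 0 ≤ S x := fun x => Finset.sum_nonneg fun i _ => abs_nonneg _
  have hSd : ∀ x : ι → ℝ, (∀ i, x i ∈ Set.Icc (-1 : ℝ) 1) → S x ≤ Fintype.card ι := fun x hx => l1Norm_le_card hx
  have hFsum : ∀ D x, F D x = ∑ p ∈ range (D + 1), (t * S x) ^ p / (p.factorial : ℝ) := fun D x =>
    Finset.sum_congr rfl fun p _ => by rw [mul_pow]; ring
  -- the price of every Taylor polynomial
  have hB0 : 0 ≤ 96 / (1 + Real.log r⁻¹) :=
    div_nonneg (by norm_num) (by linarith [Real.log_nonneg ((one_le_inv₀ hr0).2 hr1)])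
  have hprice : ∀ D, |∫ x, F D x ∂P - ∫ x, F D x ∂Q| ≤ (Real.exp (t * Fintype.card ι) - 1) * (96 / (1 + Real.log r⁻¹)) := by
    intro D
    refine (abs_integral_l1NormSeries_sub_le hP hQ hr0 hr1 hmom (fun p => t ^ p / (p.factorial : ℝ)) D).trans
      (mul_le_mul_of_nonneg_right ?_ hB0)
    have hterm : ∀ p : ℕ, |t ^ (p + 1) / ((p + 1).factorial : ℝ)| * (Fintype.card ι : ℝ) ^ (p + 1) =
        (t * Fintype.card ι) ^ (p + 1) / ((p + 1).factorial : ℝ) := fun p => by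
      rw [abs_of_nonneg (by positivity), mul_pow]; ring
    rw [Finset.sum_congr rfl fun p _ => hterm p]
    have hsucc : ∑ p ∈ range (D + 1), (t * Fintype.card ι) ^ p / (p.factorial : ℝ) =
        ∑ p ∈ range D, (t * Fintype.card ι) ^ (p + 1) / ((p + 1).factorial : ℝ) + 1 := by
      rw [Finset.sum_range_succ']; simp
    have hexp := Real.sum_le_exp_of_nonneg (mul_nonneg ht (Nat.cast_nonneg (Fintype.card ι))) (D + 1)
    linarith
  -- pointwise convergence and domination on the cube
  have hlim : ∀ x, Tendsto (fun D => F D x) atTop (𝓝 (Real.exp (t * S x))) := by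
    intro x
    have h : HasSum (fun n : ℕ => (t * S x) ^ n / (n.factorial : ℝ)) (Real.exp (t * S x)) := by
      rw [Real.exp_eq_exp_ℝ]; exact NormedSpace.expSeries_div_hasSum_exp (t * S x)
    refine Tendsto.congr (fun D => ?_) (h.tendsto_sum_nat.comp (tendsto_add_atTop_nat 1))
    rw [Function.comp_apply, hFsum]
  have hbound : ∀ (D : ℕ) (x : ι → ℝ), (∀ i, x i ∈ Set.Icc (-1 : ℝ) 1) → ‖F D x‖ ≤ Real.exp (t * Fintype.card ι) := by
    intro D x hx
    have htS : 0 ≤ t * S x := mul_nonneg ht (hS0 x)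
    rw [Real.norm_eq_abs, hFsum, abs_of_nonneg (Finset.sum_nonneg fun p _ => by positivity)]
    exact (Real.sum_le_exp_of_nonneg htS _).trans (Real.exp_le_exp.2 (mul_le_mul_of_nonneg_left (hSd x hx) ht))
  have htend : ∀ (μ : Measure (ι → ℝ)) [IsProbabilityMeasure μ], μ (Set.pi Set.univ (fun _ : ι => Set.Icc (-1 : ℝ) 1))ᶜ = 0 →
      Tendsto (fun D => ∫ x, F D x ∂μ) atTop (𝓝 (∫ x, Real.exp (t * S x) ∂μ)) := by
    intro μ _ hμ
    have hae : ∀ᵐ x ∂μ, x ∈ Set.pi Set.univ (fun _ : ι => Set.Icc (-1 : ℝ) 1) := mem_ae_iff.2 hμ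
    exact tendsto_integral_of_dominated_convergence (fun _ => Real.exp (t * Fintype.card ι))
      (fun D => (hFcont D).aestronglyMeasurable) (integrable_const _)
      (fun D => hae.mono fun x hx => hbound D x fun i => Set.mem_univ_pi.1 hx i) (Eventually.of_forall hlim)
  exact le_of_tendsto' ((htend P hP).sub (htend Q hQ)).abs hprice

/-! ## §6 At the scheme: mixed absolute moments and the exponential ℓ¹-moment of `d` strings under the uniform target [bookkeeping] -/

section AtScheme

open Literature.MathematicalPhysics.QuantumFieldTheory.Balaban1983to89
open T4GenFunBounds (prodObs gibbsMeasure schemeZ)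
open Missing (TorusScheme)
open Summit.QuantumFields.BalabanUV.T4Continuum.Spine
open Summit.QuantumFields.YangMills.Theorems.BalabanUVNodesN19JointLawClosedFormAtScheme (jointLaw_pushforward)

variable {G : Type*} [GaugeGroup G] [MeasurableSpace G] [RegularGaugeGroup G] [HaarData G] {O : Type*}
  (S : TorusScheme G O) (hβ : ∀ K, 0 ≤ S.β K) (hm : ∀ K o, Measurable (S.obs K o)) (h1 : ∀ K o U, |S.obs K o U| ≤ 1)
include hβ hm h1

/-- ★ **MIXED ABSOLUTE MOMENTS OF `d` STRINGS AT THE SCHEME: `96∕(1 + log R_K⁻¹)`, NO `a`, NO `d`.**  Under `Spine.NE7.Target vol l₀ δ (schemeZ S os)`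
for EVERY string (`0 < l₀`), for a finite family `os : ι → List O` with a continuum joint law `ν` on `[−1,1]^ι` receiving all continuous
functionals, every exponent vector `a`, and every step `K` at which `R_K = (4e^{1+l₀}∕l₀)·τ_K·(1 + log⁺τ_K⁻¹) ∈ (0, 1]`:
`|∫ ∏_i|∏os_i|^{a_i} dgibbs_K − ∫ ∏_i|x_i|^{a_i} dν| ≤ 96∕(1 + log R_K⁻¹)` (§2 at `r = R_K` on module 67's push-forward).  CONDITIONAL on the uniform
`Target`; nothing of Bałaban's instantiated. [bookkeeping] -/
theorem abs_integral_prodAbsPow_sub_jointLaw_le_of_uniformTarget {vol l₀ : ℝ} {δ : ℕ → ℝ}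
    (hl₀ : 0 < l₀) (hT : ∀ os : List O, NE7.Target vol l₀ δ (schemeZ S os)) (os : ι → List O) (ν : Measure (ι → ℝ)) [IsProbabilityMeasure ν]
    (hν1 : ν (Set.pi Set.univ (fun _ : ι => Set.Icc (-1 : ℝ) 1))ᶜ = 0)
    (hν : ∀ f : (ι → ℝ) → ℝ, Continuous f →
      Tendsto (fun K => ∫ U, f (fun i => prodObs S K (os i) U) ∂gibbsMeasure (S.P K) (S.β K)) atTop (𝓝 (∫ x, f x ∂ν)))
    (a : ι → ℕ) (K : ℕ)
    (hR0 : 0 < 4 * Real.exp (1 + l₀) / l₀ * (∑' j, 2 * (vol * δ (K + j))) * (1 + Real.posLog (∑' j, 2 * (vol * δ (K + j)))⁻¹))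
    (hR1 : 4 * Real.exp (1 + l₀) / l₀ * (∑' j, 2 * (vol * δ (K + j))) * (1 + Real.posLog (∑' j, 2 * (vol * δ (K + j)))⁻¹) ≤ 1) :
    |∫ U, ∏ i, |prodObs S K (os i) U| ^ a i ∂gibbsMeasure (S.P K) (S.β K) - ∫ x, ∏ i, |x i| ^ a i ∂ν| ≤
      96 / (1 + Real.log (4 * Real.exp (1 + l₀) / l₀ * (∑' j, 2 * (vol * δ (K + j))) * (1 + Real.posLog (∑' j, 2 * (vol * δ (K + j)))⁻¹))⁻¹) := by
  obtain ⟨P, iP, hPc, hint, -, hmom⟩ := jointLaw_pushforward S hβ hm h1 hl₀ hT os ν hν K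
  have hc : Continuous fun x : ι → ℝ => ∏ i, |x i| ^ a i := continuous_finsetProd _ fun i _ => (continuous_apply i).abs.pow _
  rw [← hint hc]
  exact abs_integral_prodAbsPow_sub_le hPc hν1 hR0 hR1 hmom a

/-- ★ **THE EXPONENTIAL ℓ¹-MOMENT OF `d` STRINGS AT THE SCHEME: `(e^{td} − 1)·96∕(1 + log R_K⁻¹)`.**  In the setting of
`abs_integral_prodAbsPow_sub_jointLaw_le_of_uniformTarget`, for `t ≥ 0`:
`|∫ exp(t·Σ_i|∏os_i|) dgibbs_K − ∫ exp(t·Σ_i|x_i|) dν| ≤ (e^{td} − 1)·96∕(1 + log R_K⁻¹)` (§5 at `r = R_K`).  CONDITIONAL on the uniform `Target`;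
nothing of Bałaban's instantiated. [bookkeeping] -/
theorem abs_integral_exp_l1Norm_sub_jointLaw_le_of_uniformTarget {vol l₀ : ℝ} {δ : ℕ → ℝ}
    (hl₀ : 0 < l₀) (hT : ∀ os : List O, NE7.Target vol l₀ δ (schemeZ S os)) (os : ι → List O) (ν : Measure (ι → ℝ)) [IsProbabilityMeasure ν]
    (hν1 : ν (Set.pi Set.univ (fun _ : ι => Set.Icc (-1 : ℝ) 1))ᶜ = 0)
    (hν : ∀ f : (ι → ℝ) → ℝ, Continuous f →
      Tendsto (fun K => ∫ U, f (fun i => prodObs S K (os i) U) ∂gibbsMeasure (S.P K) (S.β K)) atTop (𝓝 (∫ x, f x ∂ν)))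
    {t : ℝ} (ht : 0 ≤ t) (K : ℕ)
    (hR0 : 0 < 4 * Real.exp (1 + l₀) / l₀ * (∑' j, 2 * (vol * δ (K + j))) * (1 + Real.posLog (∑' j, 2 * (vol * δ (K + j)))⁻¹))
    (hR1 : 4 * Real.exp (1 + l₀) / l₀ * (∑' j, 2 * (vol * δ (K + j))) * (1 + Real.posLog (∑' j, 2 * (vol * δ (K + j)))⁻¹) ≤ 1) :
    |∫ U, Real.exp (t * ∑ i, |prodObs S K (os i) U|) ∂gibbsMeasure (S.P K) (S.β K) - ∫ x, Real.exp (t * ∑ i, |x i|) ∂ν| ≤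
      (Real.exp (t * Fintype.card ι) - 1) *
        (96 / (1 + Real.log (4 * Real.exp (1 + l₀) / l₀ * (∑' j, 2 * (vol * δ (K + j))) * (1 + Real.posLog (∑' j, 2 * (vol * δ (K + j)))⁻¹))⁻¹)) := by
  obtain ⟨P, iP, hPc, hint, -, hmom⟩ := jointLaw_pushforward S hβ hm h1 hl₀ hT os ν hν K
  have hc : Continuous fun x : ι → ℝ => Real.exp (t * ∑ i, |x i|) :=
    Real.continuous_exp.comp (continuous_const.mul (continuous_finsetSum _ fun i _ => (continuous_apply i).abs))
  rw [← hint hc]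
  exact abs_integral_exp_l1Norm_sub_le hPc hν1 hR0 hR1 hmom ht

end AtScheme

end Summit.QuantumFields.YangMills.Theorems.BalabanUVNodesN19JointLawPriceAbsolutePolynomials

end
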